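import Literature.NumberTheory.Li1992.RallisLocalFactorEulerBounds
import Literature.NumberTheory.Li1992.RallisLocalFactorSplitAssembly
import HarnessLib

/-!
# [Li1992, Thm 2.1 (27)] — the local factors at the spherical data are `1 + O(N(v)^{-N/2})`, for almost every place `v`

J.-S. Li, J. reine angew. Math. **428** (1992), Thm 2.1 p. 184 (the Euler product (27) of Rallis' inner product formula is absolutely
convergent; at almost every place the factor is the unramified one of §5 p. 206); J. Tate, in Cassels–Fröhlich (1967), Thm 3.3.1 (the
exchange of `∫` over a restricted product with `∏` of the local integrals needs bounded partial products of `∫ |f_v|`).  Sequel of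
`RallisLocalFactorEulerBounds.lean` (the per-place algebra and the abstract Euler-product bookkeeping) and of ★ `RallisLocalFactorSplitAssembly`
∕ ★ `RallisLocalFactorUnramifiedNonsplit` (the unramified local factors at the split ∕ non-split places in the tree's currency
`ω_v = 𝓢.omegaLoc v ∘ localCenter`, `χ_{1,v} = localCharOfCenter χ₁ v`).  For a restricted family `𝓢` of local splittings of `U(J)(F_v)`
([GelbartRogawski1991, Prop. 3.1.1]) with `L²`-isometric local Weil representations, `dim J = N ≥ 2`, and a continuous unitary character
`χ₁` of the finite-adelic centre `E¹(𝔸_{F,f})`, write, at a finite place `v` of `F` and for a left-invariant measure `dh_v` on the torus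
`U(J₁)(F_v)`,
  `f_v(h) = ⟨ω_v(h·1) 1_{𝒪_vᴺ}, 1_{𝒪_vᴺ}⟩_{μ'_vᴺ} · conj χ_{1,v}(h)`,  `K_v = dh_v(U(J₁)(𝒪_v))`,  `C_v = μ'_vᴺ(𝒪_vᴺ)`.
THIS FILE proves, for all but finitely many `v` and EVERY such `dh_v` (kernel only):

* **`eventually_localFactor_unitVec_bounds`** — `f_v` is `dh_v`-integrable, `|∫ f_v dh_v − K_v C_v| ≤ 12 · K_v C_v · N(v)^{-N/2}` and
  `∫ |f_v| dh_v ≤ K_v C_v · (1 + 4 · N(v)^{-N/2})` (non-split `v`: the torus is compact `= U(J₁)(𝒪_v)`, fixes `1_{𝒪ᴺ}`, `χ_{1,v} ≡ 1`, so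
  `∫ f_v = ∫ |f_v| = K_v C_v`; split `v`: the Tate-type sums `K_v C_v (1 − r²)/|1 − α r|²` and `K_v C_v (1 + r)/(1 − r)`, `r = N(v)^{-N/2} ≤ 1/2`);
* **`eventually_localFactor_unitVec_normalised_bounds`** — with `K_v = 1` and the pairing normalised by `C_v⁻¹` (the shape of the local
  factors `fl_v` of the cell's (F2) assembly `Theorems/H413FinCoeffPureTensor`): `|I_v − 1| ≤ 12 · N(v)^{-N/2}`, `∫ |fl_v| ≤ 1 + 4 · N(v)^{-N/2}`.
Together with `Σ_v N(v)^{-N/2} < ∞` (`N ≥ 3`, ★ `Li1992.summable_absNorm_rpow_neg_half_of_three_le`) and the abstract bookkeeping ★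
`Li1992.eulerProduct_bookkeeping` this is the hypothesis «bounded partial products» of the Euler exchange and the non-vanishing of
`∏'_v I_v` given `I_v ≠ 0` at every `v` — i.e. the (F3′) row of the finite half of [Li1992, (27)] for the pair `(U(J), U(J₁))`.

KERNEL only: theorems, no definition, no named fact, no `sorry`.  Cell hodgecm-mathlib, FLOOR 0, programme P4 (F3′), crux item H413
(`--supports stmt-HodgeConjecture-24833`).  HC_CM is proved only modulo the printed citations until rung 0 closes; nothing here is a claim about them.

## References
* [Li1992] J.-S. Li, J. reine angew. Math. 428 (1992) 177–217 — Thm 2.1 (26)–(27) p. 184; §5 p. 206.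
* [TateThesis1967] J. Tate, in Cassels–Fröhlich, *Algebraic Number Theory* (1967), Ch. XV §3.2 Lemma 3.2.1, Thm 3.3.1.
* [GelbartRogawski1991] S. Gelbart, J. Rogawski, Invent. Math. 105 (1991), §3.1 Prop. 3.1.1, (3.1.3) p. 456.
-/

set_option autoImplicit false

noncomputable section

open NumberField IsDedekindDomain MeasureTheory Filter Set
open scoped Matrix NNReal Topology ComplexConjugate
open Literature.RepresentationTheory Literature.RepresentationTheory.HeisenbergGroup
open Literature.NumberTheory.Automorphic
open Literature.NumberTheory.Automorphic.UnitaryGroup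
open Literature.NumberTheory.Automorphic.Liu2021
open Literature.NumberTheory.GaloisRepresentations.IsNonarchimedeanLocalField

namespace Literature.NumberTheory.GelbartRogawski1991.UnitaryDualPair.LocalSplitting.FinLocalSplittings

variable {F : Type} [Field F] [NumberField F] {E : Type} [Field E] [NumberField E] [Algebra F E]
  [Algebra.IsQuadraticExtension F E] {c : E ≃ₐ[F] E} {N : ℕ} {δ : E} {hcδ : c δ = -δ} {hδ : δ ≠ 0} {d : F}
  {hd : δ * δ = algebraMap F E d} {T : Matrix (Fin N) (Fin N) F} {hT : T.IsSymm}
  {J : Matrix (Fin N) (Fin N) E} {hJ : J = T.map (algebraMap F E)}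
  (𝓢 : FinLocalSplittings F E c N hcδ hδ hd T hT hJ) (J₁ : Matrix (Fin 1) (Fin 1) E) (hJ₁ : J₁ 0 0 ≠ 0)
  (hTd : IsUnit T.det)

omit [NumberField E] [Algebra.IsQuadraticExtension F E] in
/-- `(𝔭_v^0)^N = 𝒪_vᴺ`: the box `piPrimePowBall F_v (Fin N) 0` of the local files is the integral box `integralBox F (Fin N) v`.
[cite: TateThesis1967, §3.2] -/
theorem piPrimePowBall_zero_eq_integralBox (v : HeightOneSpectrum (𝓞 F)) :
    piPrimePowBall (v.adicCompletion F) (Fin N) 0 = integralBox F (Fin N) v := by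
  ext x
  rw [piPrimePowBall, integralBox, Set.mem_univ_pi, Set.mem_univ_pi]
  exact forall_congr' fun i => mem_primePowBall_zero_iff (x i)

include hTd in
/-- **[Li1992 (27)]: THE LOCAL FACTORS AT THE SPHERICAL DATA ARE `1 + O(N(v)^{-N/2})`, AT ALMOST EVERY PLACE.**  For a restricted family
`𝓢` of local splittings with `ω_v` `L²(μ'_vᴺ)`-isometric, `dim J = N ≥ 2`, and a continuous unitary character `χ₁` of `E¹(𝔸_{F,f})`: for all but
finitely many `v`, for EVERY left-invariant measure `dh` on `U(J₁)(F_v)` finite on compacts and charging open sets, the local integrand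
`f_v(h) = ⟨ω_v(h·1)1_{𝒪ᴺ}, 1_{𝒪ᴺ}⟩ conj χ_{1,v}(h)` is integrable,
`|∫ f_v dh − dh(U(J₁)(𝒪_v)) μ'ᴺ(𝒪_vᴺ)| ≤ dh(U(J₁)(𝒪_v)) μ'ᴺ(𝒪_vᴺ) · 12 N(v)^{-N/2}` and
`∫ |f_v| dh ≤ dh(U(J₁)(𝒪_v)) μ'ᴺ(𝒪_vᴺ) · (1 + 4 N(v)^{-N/2})` (non-split `v`: ★ `eventually_unitVec_fixed_and_localChar_eq_one_of_nonsplit`,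
the torus is compact and equal to `U(J₁)(𝒪_v)`; split `v`: ★ `eventually_forall_exists_unit_sphericalCoeff` + ★
`integral_localFactor_unitVec_of_sphericalCoeff` ∕ ★ `integral_norm_localFactor_unitVec_of_sphericalCoeff` with `r = q_v^{-N/2} ≤ 1/2`).
[cite: Li1992, Thm 2.1 (27) p. 184; §5 p. 206] [cite: TateThesis1967, §3.2 Lemma 3.2.1, Thm 3.3.1] [cite: GelbartRogawski1991, §3.1 (3.1.3) p. 456] -/
theorem eventually_localFactor_unitVec_bounds (hJ₁c : (J₁.map c)ᵀ = J₁) (h2 : 2 ≤ N)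
    {χ₁ : finAdelicOne F E c →* ℂˣ} (hχ₁ : Continuous χ₁) (hχ₁u : ∀ x, ‖((χ₁ x : ℂˣ) : ℂ)‖ = 1)
    [∀ v : HeightOneSpectrum (𝓞 F), MeasurableSpace (v.adicCompletion F)] [∀ v : HeightOneSpectrum (𝓞 F), BorelSpace (v.adicCompletion F)]
    (μ' : ∀ v : HeightOneSpectrum (𝓞 F), Measure (v.adicCompletion F)) [∀ v, (μ' v).IsAddHaarMeasure]
    (hL2 : ∀ v : HeightOneSpectrum (𝓞 F), (𝓢.omegaLoc v).IsL2Isometric (Measure.pi fun _ : Fin N => μ' v)) :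
    ∀ᶠ v : HeightOneSpectrum (𝓞 F) in cofinite,
      ∀ [MeasurableSpace (localPi E c 1 J₁ v)] [BorelSpace (localPi E c 1 J₁ v)] (dh : Measure (localPi E c 1 J₁ v))
        [dh.IsMulLeftInvariant] [IsFiniteMeasureOnCompacts dh] [dh.IsOpenPosMeasure],
        Integrable (fun h : localPi E c 1 J₁ v =>
          (∫ x, ((𝓢.omegaLoc v (localCenter E c N J J₁ hJ₁ v h) (unitVec F (Fin N) v) :
                SchwartzBruhat (Fin N → v.adicCompletion F)) : (Fin N → v.adicCompletion F) → ℂ) x *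
              conj (((unitVec F (Fin N) v : SchwartzBruhat (Fin N → v.adicCompletion F)) : (Fin N → v.adicCompletion F) → ℂ) x)
              ∂(Measure.pi fun _ : Fin N => μ' v)) *
            conj ((localCharOfCenter F E c J₁ hJ₁ χ₁ v h : ℂˣ) : ℂ)) dh ∧
        ‖(∫ h, (∫ x, ((𝓢.omegaLoc v (localCenter E c N J J₁ hJ₁ v h) (unitVec F (Fin N) v) :
                SchwartzBruhat (Fin N → v.adicCompletion F)) : (Fin N → v.adicCompletion F) → ℂ) x *
              conj (((unitVec F (Fin N) v : SchwartzBruhat (Fin N → v.adicCompletion F)) : (Fin N → v.adicCompletion F) → ℂ) x)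
              ∂(Measure.pi fun _ : Fin N => μ' v)) *
            conj ((localCharOfCenter F E c J₁ hJ₁ χ₁ v h : ℂˣ) : ℂ) ∂dh) -
            (dh.real (localInt E c 1 J₁ v : Set (localPi E c 1 J₁ v)) : ℂ) *
              ((Measure.pi fun _ : Fin N => μ' v).real (integralBox F (Fin N) v) : ℂ)‖ ≤
          dh.real (localInt E c 1 J₁ v : Set (localPi E c 1 J₁ v)) * (Measure.pi fun _ : Fin N => μ' v).real (integralBox F (Fin N) v) *
            (12 * (Ideal.absNorm v.asIdeal : ℝ) ^ (-((N : ℝ) / 2))) ∧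
        ∫ h, ‖(∫ x, ((𝓢.omegaLoc v (localCenter E c N J J₁ hJ₁ v h) (unitVec F (Fin N) v) :
                SchwartzBruhat (Fin N → v.adicCompletion F)) : (Fin N → v.adicCompletion F) → ℂ) x *
              conj (((unitVec F (Fin N) v : SchwartzBruhat (Fin N → v.adicCompletion F)) : (Fin N → v.adicCompletion F) → ℂ) x)
              ∂(Measure.pi fun _ : Fin N => μ' v)) *
            conj ((localCharOfCenter F E c J₁ hJ₁ χ₁ v h : ℂˣ) : ℂ)‖ ∂dh ≤
          dh.real (localInt E c 1 J₁ v : Set (localPi E c 1 J₁ v)) * (Measure.pi fun _ : Fin N => μ' v).real (integralBox F (Fin N) v) *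
            (1 + 4 * (Ideal.absNorm v.asIdeal : ℝ) ^ (-((N : ℝ) / 2))) := by
  have hc : c ≠ 1 := by
    rintro rfl
    exact hδ (self_eq_neg.1 (by simpa only [AlgEquiv.one_apply] using hcδ))
  haveI : NeZero N := ⟨by omega⟩
  filter_upwards [𝓢.eventually_forall_exists_unit_sphericalCoeff J₁ hJ₁ hTd μ' hJ₁c hL2, 𝓢.unramified,
    eventually_localCharOfCenter_eq_one F E c J₁ hJ₁ hχ₁,
    eventually_forall_placesOver_valued_eq_one (F := F) (J₁ 0 0) hJ₁,
    𝓢.eventually_unitVec_fixed_and_localChar_eq_one_of_nonsplit J₁ hJ₁ hχ₁] with v hcoef hunr hχv hj hns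
  intro _ _ dh _ _ _
  haveI : SecondCountableTopology (v.adicCompletion F) := secondCountableTopology_localField _
  -- the two constants and the majorant
  set K : ℝ := dh.real (localInt E c 1 J₁ v : Set (localPi E c 1 J₁ v)) with hK
  set Cb : ℝ := (Measure.pi fun _ : Fin N => μ' v).real (integralBox F (Fin N) v) with hCb
  have hK0 : 0 ≤ K := measureReal_nonneg
  have hC0 : 0 ≤ Cb := measureReal_nonneg
  have ha0 : 0 ≤ (Ideal.absNorm v.asIdeal : ℝ) ^ (-((N : ℝ) / 2)) := Real.rpow_nonneg (Nat.cast_nonneg _) _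
  have hm : MeasurableSet (integralBox F (Fin N) v) := (isOpen_integralBox F (Fin N) v).measurableSet
  obtain ⟨w⟩ := (inferInstance : Nonempty (PlacesOver E v))
  by_cases hw : c • w.1 = w.1
  · -- NON-SPLIT: the torus is compact, `= U(J₁)(𝒪_v)`, fixes `1_{𝒪ᴺ}`, and `χ_{1,v} ≡ 1`
    obtain ⟨hfix, htriv⟩ := hns w hw
    have htop : localInt E c 1 J₁ v = ⊤ := localInt_one_eq_top_of_smul_eq c J₁ hc hJ₁ w hw
    haveI : CompactSpace (localPi E c 1 J₁ v) := compactSpace_localPi_one_of_smul_eq c J₁ hc hJ₁ w hw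
    haveI : IsFiniteMeasure dh := ⟨isCompact_univ.measure_lt_top⟩
    have hKu : K = dh.real Set.univ := by rw [hK, htop, Subgroup.coe_top]
    have hconst : ∀ h : localPi E c 1 J₁ v,
        (∫ x, ((𝓢.omegaLoc v (localCenter E c N J J₁ hJ₁ v h) (unitVec F (Fin N) v) :
              SchwartzBruhat (Fin N → v.adicCompletion F)) : (Fin N → v.adicCompletion F) → ℂ) x *
            conj (((unitVec F (Fin N) v : SchwartzBruhat (Fin N → v.adicCompletion F)) : (Fin N → v.adicCompletion F) → ℂ) x)
            ∂(Measure.pi fun _ : Fin N => μ' v)) *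
          conj ((localCharOfCenter F E c J₁ hJ₁ χ₁ v h : ℂˣ) : ℂ) = (Cb : ℂ) := fun h => by
      rw [hfix h, htriv h, Units.val_one, map_one, mul_one, Li1992.integral_unitVec_mul_conj_unitVec F N v _ hm]
    refine ⟨(integrable_const (Cb : ℂ)).congr (Filter.Eventually.of_forall fun h => (hconst h).symm), ?_, ?_⟩
    · rw [𝓢.integral_localFactor_unitVec_of_fixed' J₁ hJ₁ v dh (Measure.pi fun _ : Fin N => μ' v)
        (localCharOfCenter F E c J₁ hJ₁ χ₁ v) hm hfix htriv, ← hCb, ← hKu, sub_self, norm_zero]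
      exact mul_nonneg (mul_nonneg hK0 hC0) (mul_nonneg (by norm_num) ha0)
    · rw [𝓢.integral_norm_localFactor_unitVec_of_fixed J₁ hJ₁ v dh (Measure.pi fun _ : Fin N => μ' v)
        (localCharOfCenter F E c J₁ hJ₁ χ₁ v) hm hfix htriv, ← hCb, ← hKu]
      exact le_mul_of_one_le_right (mul_nonneg hK0 hC0) (by linarith)
  · -- SPLIT: a generator `z₀`, the spherical coefficients, and the two Tate-type sums
    obtain ⟨z₀, hz₀⟩ := exists_generator_localPi_one_of_split c J₁ hc hJ₁c w hw (hj w)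
    obtain ⟨u, hu, hcoefz⟩ := hcoef w hw z₀ hz₀
    have hcover := exists_zpow_inv_mul_mem_of_generates J₁ v z₀ hz₀
    have hfree := zpow_mem_localInt_imp_eq_zero J₁ v w z₀ (valued_entry_eq_exp_or_of_generates F E c v hc hJ₁c w hw (hj w) z₀ hz₀)
    have hfix : ∀ k ∈ localInt E c 1 J₁ v,
        𝓢.omegaLoc v (localCenter E c N J J₁ hJ₁ v k) (unitVec F (Fin N) v) = unitVec F (Fin N) v :=
      fun k hk => hunr _ (localCenter_mapsTo_localInt E c N J J₁ hJ₁ v hk)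
    have hχK : ∀ k ∈ localInt E c 1 J₁ v, localCharOfCenter F E c J₁ hJ₁ χ₁ v k = 1 := fun k hk => hχv k hk
    have hχu := norm_localCharOfCenter F E c J₁ hJ₁ hχ₁u v z₀
    have hq2 : (2 : ℝ) ≤ (residueFieldCard (v.adicCompletion F) : ℝ) := Li1992.two_le_residueFieldCard_adicCompletion F v
    have hq1 : (1 : ℝ) < (residueFieldCard (v.adicCompletion F) : ℝ) := by linarith
    have hcard : Fintype.card (Fin N) = N := Fintype.card_fin N
    obtain ⟨hr0, hr1⟩ := Li1992.inv_sqrt_pow_nonneg_lt_one hq1 (N := Fintype.card (Fin N)) (by rw [hcard]; omega)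
    have hr2 : (Real.sqrt ((residueFieldCard (v.adicCompletion F) : ℝ) ^ Fintype.card (Fin N)))⁻¹ ≤ 1 / 2 :=
      Li1992.inv_sqrt_pow_le_half hq2 (by rw [hcard]; exact h2)
    have hra : (Real.sqrt ((residueFieldCard (v.adicCompletion F) : ℝ) ^ Fintype.card (Fin N)))⁻¹ =
        (Ideal.absNorm v.asIdeal : ℝ) ^ (-((N : ℝ) / 2)) := by
      rw [hcard, Li1992.inv_sqrt_pow_eq_rpow (by linarith) N, Li1992.residueFieldCard_adicCompletion_eq_absNorm F v]
    rw [piPrimePowBall_zero_eq_integralBox] at hcoefz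
    have hval := 𝓢.integral_localFactor_unitVec_of_sphericalCoeff J₁ hJ₁ v dh (Measure.pi fun _ : Fin N => μ' v)
      (localCharOfCenter F E c J₁ hJ₁ χ₁ v) z₀ hcover hfree hfix hχK hχu hu hr0 hr1 hcoefz
    have hnorm := 𝓢.integral_norm_localFactor_unitVec_of_sphericalCoeff J₁ hJ₁ v dh (Measure.pi fun _ : Fin N => μ' v)
      (localCharOfCenter F E c J₁ hJ₁ χ₁ v) z₀ hcover hfree hfix hχK hχu hu hr0 hr1 hcoefz
    have hα : ‖u * conj ((localCharOfCenter F E c J₁ hJ₁ χ₁ v z₀ : ℂˣ) : ℂ)‖ = 1 := by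
      rw [norm_mul, hu, Complex.norm_conj, hχu, one_mul]
    refine ⟨hval.1, ?_, ?_⟩
    · rw [hval.2, ← hK, ← hCb]
      have hX : (K : ℂ) * (Cb : ℂ) *
            (((1 - ((Real.sqrt ((residueFieldCard (v.adicCompletion F) : ℝ) ^ Fintype.card (Fin N)))⁻¹) ^ 2) /
              ‖1 - (u * conj ((localCharOfCenter F E c J₁ hJ₁ χ₁ v z₀ : ℂˣ) : ℂ)) *
                (Real.sqrt ((residueFieldCard (v.adicCompletion F) : ℝ) ^ Fintype.card (Fin N)))⁻¹‖ ^ 2 : ℝ) : ℂ) -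
            (K : ℂ) * (Cb : ℂ) =
          ((K * Cb * ((1 - ((Real.sqrt ((residueFieldCard (v.adicCompletion F) : ℝ) ^ Fintype.card (Fin N)))⁻¹) ^ 2) /
              ‖1 - (u * conj ((localCharOfCenter F E c J₁ hJ₁ χ₁ v z₀ : ℂˣ) : ℂ)) *
                (Real.sqrt ((residueFieldCard (v.adicCompletion F) : ℝ) ^ Fintype.card (Fin N)))⁻¹‖ ^ 2 - 1) : ℝ) : ℂ) := by
        push_cast
        ring
      rw [hX, Complex.norm_real, Real.norm_eq_abs, abs_mul, abs_of_nonneg (mul_nonneg hK0 hC0), ← hra]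
      exact mul_le_mul_of_nonneg_left (Li1992.abs_int_geometric_unit_sub_one_le hα hr0 hr2) (mul_nonneg hK0 hC0)
    · rw [hnorm, ← hK, Complex.norm_real, Real.norm_eq_abs, abs_of_nonneg hC0, ← hra]
      exact mul_le_mul_of_nonneg_left (Li1992.one_add_div_one_sub_le hr0 hr2) (mul_nonneg hK0 hC0)

include hTd in
/-- **NORMALISED FORM (the (F3′) row of the cell's S4′(ii) assembly).**  With `dh(U(J₁)(𝒪_v)) = 1` and the local pairing normalised by
`μ'ᴺ(𝒪_vᴺ)⁻¹` (the local factor `fl_v(h) = (μ'ᴺ(𝒪_vᴺ)⁻¹ • ⟨ω_v(h·1)1_{𝒪ᴺ}, 1_{𝒪ᴺ}⟩) · conj χ_{1,v}(h)` of the pure-tensor currency): for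
all but finitely many `v`, `fl_v` is integrable, `|∫ fl_v dh − 1| ≤ 12 N(v)^{-N/2}` and `∫ |fl_v| dh ≤ 1 + 4 N(v)^{-N/2}` — so, `N ≥ 3`,
`Σ_v N(v)^{-N/2} < ∞` (★ `summable_absNorm_rpow_neg_half_of_three_le`) feeds ★ `Li1992.eulerProduct_bookkeeping`.
[cite: Li1992, Thm 2.1 (27) p. 184; §5 p. 206] [cite: TateThesis1967, Thm 3.3.1] -/
theorem eventually_localFactor_unitVec_normalised_bounds (hJ₁c : (J₁.map c)ᵀ = J₁) (h2 : 2 ≤ N)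
    {χ₁ : finAdelicOne F E c →* ℂˣ} (hχ₁ : Continuous χ₁) (hχ₁u : ∀ x, ‖((χ₁ x : ℂˣ) : ℂ)‖ = 1)
    [∀ v : HeightOneSpectrum (𝓞 F), MeasurableSpace (v.adicCompletion F)] [∀ v : HeightOneSpectrum (𝓞 F), BorelSpace (v.adicCompletion F)]
    (μ' : ∀ v : HeightOneSpectrum (𝓞 F), Measure (v.adicCompletion F)) [∀ v, (μ' v).IsAddHaarMeasure]
    (hL2 : ∀ v : HeightOneSpectrum (𝓞 F), (𝓢.omegaLoc v).IsL2Isometric (Measure.pi fun _ : Fin N => μ' v)) :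
    ∀ᶠ v : HeightOneSpectrum (𝓞 F) in cofinite,
      ∀ [MeasurableSpace (localPi E c 1 J₁ v)] [BorelSpace (localPi E c 1 J₁ v)] (dh : Measure (localPi E c 1 J₁ v))
        [dh.IsMulLeftInvariant] [IsFiniteMeasureOnCompacts dh] [dh.IsOpenPosMeasure],
        dh (localInt E c 1 J₁ v : Set (localPi E c 1 J₁ v)) = 1 →
        Integrable (fun h : localPi E c 1 J₁ v =>
          (((Measure.pi fun _ : Fin N => μ' v) (integralBox F (Fin N) v)).toReal⁻¹ •
            ∫ x, ((𝓢.omegaLoc v (localCenter E c N J J₁ hJ₁ v h) (unitVec F (Fin N) v) :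
                SchwartzBruhat (Fin N → v.adicCompletion F)) : (Fin N → v.adicCompletion F) → ℂ) x *
              conj (((unitVec F (Fin N) v : SchwartzBruhat (Fin N → v.adicCompletion F)) : (Fin N → v.adicCompletion F) → ℂ) x)
              ∂(Measure.pi fun _ : Fin N => μ' v)) *
            conj ((localCharOfCenter F E c J₁ hJ₁ χ₁ v h : ℂˣ) : ℂ)) dh ∧
        ‖(∫ h, (((Measure.pi fun _ : Fin N => μ' v) (integralBox F (Fin N) v)).toReal⁻¹ •
            ∫ x, ((𝓢.omegaLoc v (localCenter E c N J J₁ hJ₁ v h) (unitVec F (Fin N) v) :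
                SchwartzBruhat (Fin N → v.adicCompletion F)) : (Fin N → v.adicCompletion F) → ℂ) x *
              conj (((unitVec F (Fin N) v : SchwartzBruhat (Fin N → v.adicCompletion F)) : (Fin N → v.adicCompletion F) → ℂ) x)
              ∂(Measure.pi fun _ : Fin N => μ' v)) *
            conj ((localCharOfCenter F E c J₁ hJ₁ χ₁ v h : ℂˣ) : ℂ) ∂dh) - 1‖ ≤
          12 * (Ideal.absNorm v.asIdeal : ℝ) ^ (-((N : ℝ) / 2)) ∧
        ∫ h, ‖(((Measure.pi fun _ : Fin N => μ' v) (integralBox F (Fin N) v)).toReal⁻¹ •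
            ∫ x, ((𝓢.omegaLoc v (localCenter E c N J J₁ hJ₁ v h) (unitVec F (Fin N) v) :
                SchwartzBruhat (Fin N → v.adicCompletion F)) : (Fin N → v.adicCompletion F) → ℂ) x *
              conj (((unitVec F (Fin N) v : SchwartzBruhat (Fin N → v.adicCompletion F)) : (Fin N → v.adicCompletion F) → ℂ) x)
              ∂(Measure.pi fun _ : Fin N => μ' v)) *
            conj ((localCharOfCenter F E c J₁ hJ₁ χ₁ v h : ℂˣ) : ℂ)‖ ∂dh ≤
          1 + 4 * (Ideal.absNorm v.asIdeal : ℝ) ^ (-((N : ℝ) / 2)) := by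
  filter_upwards [𝓢.eventually_localFactor_unitVec_bounds J₁ hJ₁ hTd hJ₁c h2 hχ₁ hχ₁u μ' hL2] with v hv
  intro _ _ dh _ _ _ hdh
  haveI : SecondCountableTopology (v.adicCompletion F) := secondCountableTopology_localField _
  obtain ⟨hint, hI, hA⟩ := hv dh
  -- the constants: `K = 1`, `C = μ'ᴺ(𝒪_vᴺ) > 0`
  have hK1 : dh.real (localInt E c 1 J₁ v : Set (localPi E c 1 J₁ v)) = 1 := by rw [measureReal_def, hdh, ENNReal.toReal_one]
  set Cb : ℝ := (Measure.pi fun _ : Fin N => μ' v).real (integralBox F (Fin N) v) with hCb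
  have hCpos : 0 < Cb := ENNReal.toReal_pos ((isOpen_integralBox F (Fin N) v).measure_pos _ ⟨0, zero_mem_integralBox F (Fin N) v⟩).ne'
    (isCompact_integralBox F (Fin N) v).measure_lt_top.ne
  have hCt : ((Measure.pi fun _ : Fin N => μ' v) (integralBox F (Fin N) v)).toReal = Cb := rfl
  rw [hK1] at hI hA
  simp only [Complex.ofReal_one, one_mul] at hI
  simp only [one_mul] at hA
  set f : localPi E c 1 J₁ v → ℂ := fun h =>
    (∫ x, ((𝓢.omegaLoc v (localCenter E c N J J₁ hJ₁ v h) (unitVec F (Fin N) v) :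
          SchwartzBruhat (Fin N → v.adicCompletion F)) : (Fin N → v.adicCompletion F) → ℂ) x *
        conj (((unitVec F (Fin N) v : SchwartzBruhat (Fin N → v.adicCompletion F)) : (Fin N → v.adicCompletion F) → ℂ) x)
        ∂(Measure.pi fun _ : Fin N => μ' v)) *
      conj ((localCharOfCenter F E c J₁ hJ₁ χ₁ v h : ℂˣ) : ℂ) with hfdef
  -- the normalised integrand is `C⁻¹ • f`
  have hsmul : (fun h : localPi E c 1 J₁ v =>
      (((Measure.pi fun _ : Fin N => μ' v) (integralBox F (Fin N) v)).toReal⁻¹ •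
        ∫ x, ((𝓢.omegaLoc v (localCenter E c N J J₁ hJ₁ v h) (unitVec F (Fin N) v) :
            SchwartzBruhat (Fin N → v.adicCompletion F)) : (Fin N → v.adicCompletion F) → ℂ) x *
          conj (((unitVec F (Fin N) v : SchwartzBruhat (Fin N → v.adicCompletion F)) : (Fin N → v.adicCompletion F) → ℂ) x)
          ∂(Measure.pi fun _ : Fin N => μ' v)) *
        conj ((localCharOfCenter F E c J₁ hJ₁ χ₁ v h : ℂˣ) : ℂ)) = fun h => Cb⁻¹ • f h := by
    funext h
    rw [hCt, hfdef, smul_mul_assoc]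
  refine ⟨?_, ?_, ?_⟩
  · rw [hsmul]
    exact hint.smul Cb⁻¹
  · rw [hsmul, integral_smul]
    have h1 : Cb⁻¹ • (∫ h, f h ∂dh) - 1 = Cb⁻¹ • ((∫ h, f h ∂dh) - (Cb : ℂ)) := by
      rw [smul_sub]
      congr 1
      rw [Complex.real_smul, Complex.ofReal_inv, inv_mul_cancel₀ (Complex.ofReal_ne_zero.2 hCpos.ne')]
    rw [h1, norm_smul, norm_inv, Real.norm_eq_abs, abs_of_pos hCpos]
    refine le_trans (mul_le_mul_of_nonneg_left hI (inv_nonneg.2 hCpos.le)) (le_of_eq ?_)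
    rw [← mul_assoc, inv_mul_cancel₀ hCpos.ne', one_mul]
  · simp_rw [smul_mul_assoc, norm_smul, norm_inv, hCt, Real.norm_eq_abs, abs_of_pos hCpos]
    rw [integral_const_mul]
    refine le_trans (mul_le_mul_of_nonneg_left hA (inv_nonneg.2 hCpos.le)) (le_of_eq ?_)
    rw [← mul_assoc, inv_mul_cancel₀ hCpos.ne', one_mul]

end Literature.NumberTheory.GelbartRogawski1991.UnitaryDualPair.LocalSplitting.FinLocalSplittings

end
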